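import Summits.NavierStokesRegularity.NavierStokesRegularity.Theses.DssFarFieldSlaving

/-!
# Route DssFarFieldSlaving — support item `ThesisOfCruxes` (stmt-NavierStokesRegularity-14481)

The route's target `Thesis` is, verbatim, the conjunction `B ∧ H1` of the two cruxes
`DssTruncationBridge` (B, the truncation bridge) and `BlowupTypeIDssProfile`
(H1, failure of Tsai's Type-I (rotated) λ-DSS Liouville conjecture, unfolded one level).
The glue `ThesisOfCruxes : DssTruncationBridge → BlowupTypeIDssProfile → Thesis` is therefore
pure logic: the anonymous constructor after unfolding the three definitions.
-/

-- the summit and its single sub-problem share the name (CONVENTIONS §1), as in every Theorems file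
set_option linter.dupNamespace false

namespace Summit.NavierStokesRegularity.NavierStokesRegularity.Theorems

open Summit.NavierStokesRegularity.NavierStokesRegularity.Theses.DssFarFieldSlaving

/-- **Support glue of route `DssFarFieldSlaving`** (item stmt-NavierStokesRegularity-14481):
the two cruxes `DssTruncationBridge` (B) and `BlowupTypeIDssProfile` (H1) give the route's
target `Thesis = B ∧ H1`. Both conjuncts of `Thesis` are definitionally the bodies of the two
crux definitions, so the proof is the pair `⟨hB, hP⟩`. -/
theorem thesisOfCruxes_proof :
    Summit.NavierStokesRegularity.NavierStokesRegularity.Theses.DssFarFieldSlaving.ThesisOfCruxes := by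
  unfold ThesisOfCruxes
  intro hB hP
  unfold DssTruncationBridge at hB
  unfold BlowupTypeIDssProfile at hP
  unfold Thesis
  exact ⟨hB, hP⟩

end Summit.NavierStokesRegularity.NavierStokesRegularity.Theorems
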